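import Literature.Probability.Percolation.ArmSeparationNonvacuity
import Literature.Probability.Percolation.SiteHarrisChain
import Literature.Probability.Percolation.TriThetaHalf
import HarnessLib

/-!
# Inward extension of well-separated arms at constant cost (Nolin 2008, Prop. 12 (i), inner boundary)

Topic: Probability / Percolation; family `crit-perc` (critical site percolation on `𝕋`,
`P = P_{1/2} = triSitePercolation half`). A brick of the discharge of
`Literature.Probability.Percolation.Nolin2008_twoArm_separation` (Nolin 2008, Thm. 11
[arXiv 0711.4948: Thm. 10], `j = 2`, `σ = BW`; `ArmSeparation.lean`): the constant-cost
extension step `h K ≤ C₀ · h (K+1)` of the multi-scale scheme (`ArmSeparationScheme.lean`) read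
INWARD, for the landed well-separated two-arm event `sepTwoArm` of `ArmSeparation.lean`:

  `P(sepTwoArm m N) ≤ C₀ · P(sepTwoArm m' N)`  for `1100 ≤ m'`, `2m' + 1 ≤ m ≤ 3m'`, `2m ≤ N`,

with a universal constant `C₀` (Nolin 2008, Prop. 12 (i) "once well-separated, the arms can
easily be extended" [arXiv Prop. 11], applied on the internal boundary: the internal analogue of
§4.4's constant-cost step at the macroscopic separation size, which is printed for external
extremities ("going from `∂S_m` to `∂S_{2m}` has a cost `C'₀` depending only on `η'₀`", p. 12)
followed by "the reasoning is the same for internal extremities" (p. 13)). As printed, the proof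
is a finite RSW gluing construction combined with the generalised FKG inequality for locally
monotone events (Nolin's Lemma 13 [arXiv Lemma 12], `triSitePercolation_locallyMonotone_fkg`):

* `sepInCorr m m'` — the **inward corridor** (highway rows `[-(sepGlueHeight m), 0]`,
  `sepGlueHeight m = m - m/4 + m/64` of `ArmSeparation.lean`) (all crossings open, all boxes in the right half of
  `Λ̊_m`): a vertical crossing of the target inner free space at the landing site
  `z'' = (m', -m'/2)` of `∂Λ_{m'}`, a horizontal box from inside that free space to the "highway"
  column band `[m - 2(m/8) - 2, m - (m/8) - 2]`, a vertical crossing of the highway, and the `90`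
  "comb" boxes `[m - 2(m/8) - 2, m - 1] × [g_i, g_i + h]` (`h = (m/64)/2`) covering all the rows met
  by the inner free spaces `sepInnerFence m z'`, `z' ∈ sepLanding m`;
* `sepOpenArm_inter_sepInCorr_subset` — **deterministic gluing**: `sepOpenArm m N ∩ sepInCorr m m' ⊆
  sepOpenArm m' N` (the old inner free space is crossed horizontally by one of the comb boxes,
  which meets the highway, which meets the horizontal box, which meets the new free space; the
  outer half of the arm is kept); by the symmetry `negFlip` the same corridor reflected serves the
  closed arm (`sepTwoArm_inter_sepInCorr_subset`);
* `le_real_sepInCorr` — `P(sepInCorr m m') ≥ c₂₅₆^93` (RSW at aspect ratio `256`, Harris);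
* `real_sepTwoArm_mul_le` — the extension inequality (and `exists_real_sepTwoArm_le_mul_inward`), by Nolin's Lemma 13 with the
  shared region `{m ≤ |v|}`, the right half of `Λ̊_m` (open arm's inner free spaces and corridor)
  and its left half (closed arm's), and the invariance of `P_{1/2}` under `negFlip`.

## References

* P. Nolin, *Near-critical percolation in two dimensions*, Electron. J. Probab. 13 (2008), §4.3
  Prop. 12 (i) and Lemma 13, §4.4 (proof of Thm. 11, internal extremities) [arXiv 0711.4948:
  Prop. 11, Lemma 12, Thm. 10]. [Nolin2008]
* H. Kesten, *Scaling relations for 2D-percolation*, Comm. Math. Phys. 109 (1987), Lemma 2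
  (extension of arms through fences). [Kesten1987]

Tree: `sepOpenArm`, `sepTwoArm`, `sepInnerFence`, `sepLanding`, `sepJoinRegion`, `negFlip`,
`OpenVCrossThrough` (`ArmSeparation.lean`); `isUpperSet_sepOpenArm`, `determinedBy_sepOpenArm`,
`IsUpperSet.preimage_negFlip`, `DeterminedBy.preimage_negFlip`, `triSitePercolation_real_preimage_negFlip`
(`ArmSeparationProofs.lean`); `sepSupportSet`, `PathIn.relay`, `triNorm_le_of_mem_sepInnerFence`
(`ArmSeparationGlue.lean`); `exists_mem_of_cross` (`ArmEventsAPriori.lean`);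
`triSitePercolation_locallyMonotone_fkg` (`LocallyMonotoneFKG.lean`); `triHCross`, `triVCross` and
their API (`TriRSWChaining.lean`); `sitePercolation_real_biInter_ge_prod` (`SiteHarrisChain.lean`);
`tri_rsw_half_holds` (`TriThetaHalf.lean`).
-/

noncomputable section

open MeasureTheory Set

namespace Literature.Probability.Percolation

open LatticeModels

/-! ### The inward corridor -/

/-- The `i`-th comb box `[m - 2(m/8) - 2, m - 1] × [g_i, g_i + h]`, `g_i = -(m - m/4 + m/64) + i h`,
`h = (m/64)/2`, crossed horizontally. [cite: Nolin2008, §4.3 Prop. 12 (proof) (arXiv 0711.4948: Prop. 11)] -/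
def sepInComb (m i : ℕ) : Set (SiteConfig (Site 2)) :=
  triHCross ((m : ℤ) - 2 * (m / 8 : ℕ) - 2) (-(sepGlueHeight m : ℤ) + i * ((m / 64 / 2 : ℕ) : ℤ)) (2 * (m / 8) + 1) (m / 64 / 2)

/-- Membership in the strip of a comb box. [folklore] -/
theorem sepInComb_strip_iff {m i : ℕ} {v : Site 2} :
    v ∈ triStrip ((m : ℤ) - 2 * (m / 8 : ℕ) - 2) (-(sepGlueHeight m : ℤ) + i * ((m / 64 / 2 : ℕ) : ℤ)) (2 * (m / 8) + 1) (m / 64 / 2) ↔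
      (m : ℤ) - 2 * (m / 8 : ℕ) - 2 ≤ v 0 ∧ v 0 ≤ (m : ℤ) - 1 ∧
        -(sepGlueHeight m : ℤ) + i * ((m / 64 / 2 : ℕ) : ℤ) ≤ v 1 ∧ v 1 ≤ -(sepGlueHeight m : ℤ) + i * ((m / 64 / 2 : ℕ) : ℤ) + (m / 64 / 2 : ℕ) := by
  rw [mem_triStrip]; simp only [Nat.cast_add, Nat.cast_mul, Nat.cast_ofNat, Nat.cast_one]; omega

/-- **The inward corridor** from the inner free spaces at scale `m` (right side of `Λ_m`) to the
inner free space `sepInnerFence m' (m', -m'/2)` at scale `m'`: (i) an open vertical crossing of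
the thinned target free space `[m' - m'/8 + 1, m' - 1] × [-m'/2 - m'/64, -m'/2 + m'/64]`; (ii) an
open horizontal crossing of `[m' - m'/8 + 1, m - m/8 - 2] × [-m'/2, -m'/2 + m'/64]`; (iii) an open
vertical crossing of the highway `[m - 2(m/8) - 2, m - m/8 - 2] × [-(m - m/4 + m/64), 0]`; (iv) the
`90` comb boxes crossed horizontally. [cite: Nolin2008, §4.3 Prop. 12 (proof) (arXiv 0711.4948: Prop. 11)] -/
def sepInCorr (m m' : ℕ) : Set (SiteConfig (Site 2)) :=
  triVCross ((m' : ℤ) - (m' / 8 : ℕ) + 1) (-((m' / 2 : ℕ) : ℤ) - (m' / 64 : ℕ)) (m' / 8 - 2) (2 * (m' / 64)) ∩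
    triHCross ((m' : ℤ) - (m' / 8 : ℕ) + 1) (-((m' / 2 : ℕ) : ℤ)) (m - m / 8 - m' + m' / 8 - 3) (m' / 64) ∩
    triVCross ((m : ℤ) - 2 * (m / 8 : ℕ) - 2) (-(sepGlueHeight m : ℤ)) (m / 8) (sepGlueHeight m) ∩
    ⋂ i ∈ Finset.range 90, sepInComb m i

/-- `sepInCorr` is increasing. [folklore] -/
theorem isUpperSet_sepInCorr (m m' : ℕ) : IsUpperSet (sepInCorr m m') := by
  refine (((isUpperSet_triVCross _ _ _ _).inter (isUpperSet_triHCross _ _ _ _)).inter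
    (isUpperSet_triVCross _ _ _ _)).inter ?_
  exact isUpperSet_iInter₂ fun i _ => isUpperSet_triHCross _ _ _ _

/-! ### Arithmetic of the scales -/

/-- **Tiles.** For `h ≥ 1` and `0 ≤ D ≤ n h` there is `i ≤ n` with `D ≤ i h ≤ D + h - 1`
(take `i = ⌈D / h⌉`). [folklore] -/
theorem exists_tile_index {h n : ℕ} (hh : 1 ≤ h) {D : ℤ} (hD : 0 ≤ D) (hDn : D ≤ (n : ℤ) * h) :
    ∃ i : ℕ, i ≤ n ∧ D ≤ (i : ℤ) * h ∧ (i : ℤ) * h ≤ D + h - 1 := by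
  have hh0 : (0 : ℤ) < h := by exact_mod_cast hh
  set c : ℤ := (D + h - 1) / h with hc
  have hdiv : (h : ℤ) * c + (D + h - 1) % h = D + h - 1 := Int.mul_ediv_add_emod _ _
  have hr0 : 0 ≤ (D + h - 1) % h := Int.emod_nonneg _ hh0.ne'
  have hr1 : (D + h - 1) % h < h := Int.emod_lt_of_pos _ hh0
  have hc0 : 0 ≤ c := Int.ediv_nonneg (by omega) hh0.le
  have hcn : c ≤ n := by
    by_contra hlt
    rw [not_le] at hlt
    have : (h : ℤ) * (n + 1) ≤ h * c := mul_le_mul_of_nonneg_left (by omega) hh0.le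
    nlinarith
  refine ⟨c.toNat, by omega, ?_, ?_⟩
  · have e : ((c.toNat : ℕ) : ℤ) = c := Int.toNat_of_nonneg hc0
    rw [e]; nlinarith
  · have e : ((c.toNat : ℕ) : ℤ) = c := Int.toNat_of_nonneg hc0
    rw [e]; nlinarith

/-- **The comb covers every inner free space**: for a landing site `z' ∈ sepLanding m`
(`m ≥ 2200`), some comb box `i < 90` has its rows inside the rows `[z'₁ - m/64, z'₁ + m/64]` of
`sepInnerFence m z'`. [cite: Nolin2008, §4.3 Prop. 12 (proof) (arXiv 0711.4948: Prop. 11)] -/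
theorem exists_sepInComb_rows {m : ℕ} (hm : 2200 ≤ m) {z' : Site 2} (hz' : z' ∈ sepLanding m) :
    ∃ i : ℕ, i < 90 ∧ z' 1 - (m / 64 : ℕ) ≤ -(sepGlueHeight m : ℤ) + i * ((m / 64 / 2 : ℕ) : ℤ) ∧
      -(sepGlueHeight m : ℤ) + i * ((m / 64 / 2 : ℕ) : ℤ) + (m / 64 / 2 : ℕ) ≤ z' 1 + (m / 64 : ℕ) := by
  rw [mem_sepLanding] at hz'
  obtain ⟨-, h1, h2⟩ := hz'
  set h : ℕ := m / 64 / 2 with hh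
  set B : ℕ := m / 64 with hB
  set Q : ℕ := m / 4 with hQ
  have hh1 : 1 ≤ h := by omega
  have hHe : (sepGlueHeight m : ℤ) = (m : ℤ) - Q + B := by
    unfold sepGlueHeight; push_cast [Nat.sub_add_eq, hQ, hB]; omega
  -- `D = z'₁ - B + height ≥ 0`
  set D : ℤ := z' 1 - B + (sepGlueHeight m : ℤ) with hD
  have hD0 : 0 ≤ D := by rw [hD, hHe]; omega
  have hDn : D ≤ (88 : ℕ) * (h : ℤ) := by
    rw [hD, hHe]
    have : (m : ℤ) - 2 * Q ≤ 88 * (h : ℤ) := by omega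
    push_cast; omega
  obtain ⟨i, hi, hiD, hiD'⟩ := exists_tile_index hh1 hD0 hDn
  refine ⟨i, by omega, ?_, ?_⟩
  · rw [hD] at hiD; omega
  · rw [hD] at hiD'
    have : 2 * (h : ℤ) ≤ B := by omega
    omega

/-! ### Regions -/

section Regions

variable {m m' N : ℕ}

/-- Casting the width of the horizontal box. [folklore] -/
theorem cast_sepInCorr_width (hm' : 64 ≤ m') (hmm' : 2 * m' + 1 ≤ m) :
    ((m - m / 8 - m' + m' / 8 - 3 : ℕ) : ℤ) = (m : ℤ) - (m / 8 : ℕ) - m' + (m' / 8 : ℕ) - 3 := by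
  omega

/-- The horizontal box `[m' - m'/8 + 1, m - m/8 - 2] × [-m'/2, -m'/2 + m'/64]` lies in the new
arm region: its sites inside `Λ̊_{m'}` are in the attaching ball `S̊_{m'/8}(z'')`, the others in the
annulus `{m' ≤ |v| ≤ N}` (`64 ≤ m'`, `2m' + 1 ≤ m ≤ N`). [cite: Nolin2008, §4.2 Def. 6–7 (arXiv 0711.4948)] -/
theorem sepInCorrHBox_subset_sepJoinRegion (hm' : 64 ≤ m') (hmm' : 2 * m' + 1 ≤ m) (hN : m ≤ N) (z : Site 2) :
    triStrip ((m' : ℤ) - (m' / 8 : ℕ) + 1) (-((m' / 2 : ℕ) : ℤ)) (m - m / 8 - m' + m' / 8 - 3) (m' / 64) ⊆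
      sepJoinRegion m' N z ![(m' : ℤ), -((m' / 2 : ℕ) : ℤ)] := by
  intro v hv
  rw [mem_triStrip, cast_sepInCorr_width hm' hmm'] at hv
  have hN' : (m : ℤ) ≤ N := by exact_mod_cast hN
  rcases le_or_gt (m' : ℤ) (v 0) with h0 | h0
  · refine Or.inl (Or.inl ⟨le_triNorm_iff_lin.2 (Or.inl h0), triNorm_le_iff_lin.2 ?_⟩)
    omega
  · refine Or.inr ?_
    rw [mem_triOpenBall, triNorm_lt_iff_lin]
    simp only [Pi.sub_apply, site_mk_apply_zero, site_mk_apply_one]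
    omega

/-- The highway and the comb boxes lie in the annulus `{m' ≤ |v| ≤ N}`: columns in
`[m - 2(m/8) - 2, m - 1]`, rows in `[-(m - m/4 + m/64), 0]` (`2m' + 1 ≤ m ≤ N`, `16 ≤ m`). [folklore] -/
theorem mem_triAnnulusSet_of_cols_rows (hmm' : 2 * m' + 1 ≤ m) (hm : 16 ≤ m) (hN : m ≤ N) {v : Site 2}
    (h0 : (m : ℤ) - 2 * (m / 8 : ℕ) - 2 ≤ v 0) (h0' : v 0 ≤ (m : ℤ) - 1) (h1 : -(sepGlueHeight m : ℤ) ≤ v 1) (h1' : v 1 ≤ 0) :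
    v ∈ triAnnulusSet m' N := by
  have hN' : (m : ℤ) ≤ N := by exact_mod_cast hN
  have hH : (sepGlueHeight m : ℤ) ≤ (m : ℤ) - (m / 4 : ℕ) + (m / 64 : ℕ) := by unfold sepGlueHeight; omega
  refine ⟨le_triNorm_iff_lin.2 (Or.inl (by omega)), triNorm_le_iff_lin.2 ?_⟩
  omega

/-- An inner free space at scale `m` lies in the annulus `{m' ≤ |v| ≤ N}` (`m' ≤ m - m/8`, `m ≤ N`). [cite: Nolin2008, §4.2 Def. 6–7 (arXiv 0711.4948)] -/
theorem sepInnerFence_subset_triAnnulusSet (hmm' : 2 * m' + 1 ≤ m) (hN : m ≤ N) {z' : Site 2} (hz' : z' ∈ sepLanding m) :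
    sepInnerFence m z' ⊆ triAnnulusSet m' N := by
  intro v hv
  have hvn := triNorm_le_of_mem_sepInnerFence hz' hv
  rw [mem_sepInnerFence] at hv
  have hN' : (m : ℤ) ≤ N := by exact_mod_cast hN
  exact ⟨le_triNorm_iff_lin.2 (Or.inl (by omega)), hvn.trans hN'⟩

/-- The old arm region lies in the new one: `sepJoinRegion m N z z' ⊆ sepJoinRegion m' N z z''`
(`2m' + 1 ≤ m`, `2m ≤ N`; the inner attaching ball at scale `m` lies in the annulus
`{m' ≤ |v| ≤ N}`). [cite: Nolin2008, §4.2 Def. 6–7 (arXiv 0711.4948)] -/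
theorem sepJoinRegion_subset_sepJoinRegion (hmm' : 2 * m' + 1 ≤ m) (hN : 2 * m ≤ N) {z z' : Site 2}
    (hz' : z' ∈ sepLanding m) (z'' : Site 2) : sepJoinRegion m N z z' ⊆ sepJoinRegion m' N z z'' := by
  rw [mem_sepLanding] at hz'
  obtain ⟨hz0, hz1, hz2⟩ := hz'
  have hN' : 2 * (m : ℤ) ≤ N := by exact_mod_cast hN
  have hmm : 2 * (m' : ℤ) + 1 ≤ m := by exact_mod_cast hmm'
  rintro v ((hv | hv) | hv)
  · rw [mem_triAnnulusSet] at hv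
    exact Or.inl (Or.inl ⟨by omega, hv.2⟩)
  · exact Or.inl (Or.inr hv)
  · rw [mem_triOpenBall, triNorm_lt_iff_lin] at hv
    simp only [Pi.sub_apply] at hv
    refine Or.inl (Or.inl ⟨le_triNorm_iff_lin.2 (Or.inl (by omega)), triNorm_le_iff_lin.2 ?_⟩)
    omega

/-- The thinned target free space lies in the target free space `sepInnerFence m' z''`,
`z'' = (m', -m'/2)` (`16 ≤ m'`). [folklore] -/
theorem sepInCorrFence_subset_sepInnerFence (hm' : 16 ≤ m') :
    triStrip ((m' : ℤ) - (m' / 8 : ℕ) + 1) (-((m' / 2 : ℕ) : ℤ) - (m' / 64 : ℕ)) (m' / 8 - 2) (2 * (m' / 64)) ⊆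
      sepInnerFence m' ![(m' : ℤ), -((m' / 2 : ℕ) : ℤ)] := by
  intro v hv
  rw [mem_triStrip] at hv
  rw [mem_sepInnerFence, site_mk_apply_one]
  have e : ((m' / 8 - 2 : ℕ) : ℤ) = (m' / 8 : ℕ) - 2 := by omega
  rw [e] at hv
  push_cast at hv
  omega

/-- The new landing site `z'' = (m', -m'/2)` lies in the landing zone of `∂Λ_{m'}`. [cite: Nolin2008, §4.2 Def. 8 (arXiv 0711.4948)] -/
theorem mk_mem_sepLanding (m' : ℕ) : (![(m' : ℤ), -((m' / 2 : ℕ) : ℤ)] : Site 2) ∈ sepLanding m' := by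
  rw [mem_sepLanding, site_mk_apply_zero, site_mk_apply_one]
  omega

end Regions

/-! ### The deterministic gluing -/

/-- **Inward extension of a fenced open arm along the corridor** (Nolin 2008, Prop. 12 (i) on
the internal boundary, "once well-separated, the arms can easily be extended"; Kesten's
fences): `sepOpenArm m N ∩ sepInCorr m m' ⊆ sepOpenArm m' N` for `1100 ≤ m'`, `2m' + 1 ≤ m`, `2m ≤ N`. The vertical crossing of the thinned target free space meets the horizontal box
(`exists_mem_of_cross`) at the new attaching site `p₁`; the horizontal box meets the highway, the
highway meets the comb box whose rows lie inside the old inner free space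
(`exists_sepInComb_rows`), that comb box meets the vertical crossing of the old free space through
the old attaching site `u` (`PathIn.relay`, three times), and the old arm continues from `u` to
the outer free space; all pieces lie in the new arm region `sepJoinRegion m' N z z''`. [cite: Nolin2008, §4.3 Prop. 12 (i) (proof) (arXiv 0711.4948: Prop. 11)] -/
theorem sepOpenArm_inter_sepInCorr_subset {m m' N : ℕ} (hm' : 1100 ≤ m') (hmm' : 2 * m' + 1 ≤ m) (hN : 2 * m ≤ N) :
    sepOpenArm m N ∩ sepInCorr m m' ⊆ sepOpenArm m' N := by
  rintro ω ⟨⟨z, z', u, u', hz, hz', ⟨b, t, hb, ht, Pa, Pb⟩, hOut, P5⟩, ⟨⟨⟨hV0, hH0⟩, hVh⟩, hG⟩⟩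
  have hzL := hz'
  rw [mem_sepLanding] at hzL
  obtain ⟨hz'0, hz'1, hz'2⟩ := hzL
  -- the new landing site
  set z'' : Site 2 := ![(m' : ℤ), -((m' / 2 : ℕ) : ℤ)] with hz''
  have hz''1 : z'' 1 = -((m' / 2 : ℕ) : ℤ) := site_mk_apply_one _ _
  -- the corridor paths
  obtain ⟨b₀, t₀, hb₀, ht₀, PV⟩ := hV0
  obtain ⟨a₀, e₀, ha₀, he₀, PH⟩ := hH0
  obtain ⟨bh, th, hbh, hth, PVh⟩ := hVh
  obtain ⟨i, hi, hgi1, hgi2⟩ := exists_sepInComb_rows (by omega) hz'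
  have hGi : ω ∈ sepInComb m i := (Set.mem_iInter₂.1 hG) i (Finset.mem_range.2 hi)
  obtain ⟨g₀, g₁, hg₀, hg₁, PG⟩ := hGi
  rw [cast_sepInCorr_width (by omega) hmm'] at he₀
  have hH : (sepGlueHeight m : ℤ) = (m : ℤ) - (m / 4 : ℕ) + (m / 64 : ℕ) := by unfold sepGlueHeight; omega
  simp only [Nat.cast_add, Nat.cast_mul, Nat.cast_ofNat, Nat.cast_one] at ht₀ hth hg₁
  have hih : (0 : ℤ) ≤ (i : ℤ) * ((m / 64 / 2 : ℕ) : ℤ) := by positivity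
  have hih' : (i : ℤ) * ((m / 64 / 2 : ℕ) : ℤ) ≤ 89 * ((m / 64 / 2 : ℕ) : ℤ) :=
    mul_le_mul_of_nonneg_right (by exact_mod_cast Nat.le_of_lt_succ hi) (by positivity)
  -- junction 1: the vertical crossing of the target free space meets the horizontal box
  obtain ⟨SH, hSH, PH', TH⟩ := PH.exists_support
  obtain ⟨SV, hSV, PV', TV⟩ := PV.exists_support
  obtain ⟨p₁, hp₁H, hp₁V⟩ := exists_mem_of_cross (L := (m' : ℤ) - (m' / 8 : ℕ) + 1) (R := (m' : ℤ) - 1)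
    (B := -((m' / 2 : ℕ) : ℤ) - (m' / 64 : ℕ)) (T := -((m' / 2 : ℕ) : ℤ) + (m' / 64 : ℕ)) (by omega) (by omega)
    PH' ha₀.le (by omega)
    (fun v hv _ _ => by have h := (hSH hv).1; rw [mem_triStrip] at h; omega)
    PV' hb₀.le (by omega)
    (fun v hv _ _ => by
      have h := (hSV hv).1; rw [mem_triStrip] at h
      have e : ((m' / 8 - 2 : ℕ) : ℤ) = (m' / 8 : ℕ) - 2 := by omega
      omega)
  -- the new free space is crossed through `p₁`
  have hSVF : SV ⊆ sepInnerFence m' z'' ∩ ω := fun v hv => ⟨sepInCorrFence_subset_sepInnerFence (by omega) (hSV hv).1, (hSV hv).2⟩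
  have hFence : OpenVCrossThrough (sepInnerFence m' z'') (z'' 1 - (m' / 64 : ℕ)) (z'' 1 + (m' / 64 : ℕ)) ω p₁ :=
    ⟨b₀, t₀, by rw [hz''1, hb₀], by rw [hz''1, ht₀]; ring, (TV p₁ hp₁V).mono hSVF,
      ((TV p₁ hp₁V).symm.trans (TV t₀ PV'.right_mem)).mono hSVF⟩
  -- junctions 2–4 by relays
  have Q1 : PathIn triGraph (triStrip ((m' : ℤ) - (m' / 8 : ℕ) + 1) (-((m' / 2 : ℕ) : ℤ)) (m - m / 8 - m' + m' / 8 - 3) (m' / 64) ∩ ω)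
      p₁ a₀ := (TH p₁ hp₁H).symm.mono hSH
  have Q2 := PathIn.relay (L := (m : ℤ) - 2 * (m / 8 : ℕ) - 2) (R := (m : ℤ) - (m / 8 : ℕ) - 2)
    (B := -(sepGlueHeight m : ℤ)) (T := 0) (by omega) (by omega) PH (by omega) (by omega)
    (fun v hv _ _ => by rw [mem_triStrip] at hv; omega) PVh hbh.le (by omega)
    (fun v hv _ _ => by rw [mem_triStrip] at hv; omega)
  have Q3 := PathIn.relay (L := (m : ℤ) - 2 * (m / 8 : ℕ) - 2) (R := (m : ℤ) - (m / 8 : ℕ) - 2)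
    (B := -(sepGlueHeight m : ℤ)) (T := 0) (by omega) (by omega) PG hg₀.le (by omega)
    (fun v hv _ _ => by rw [sepInComb_strip_iff] at hv; omega) PVh hbh.le (by omega)
    (fun v hv _ _ => by rw [mem_triStrip] at hv; omega)
  have Q4 := PathIn.relay (L := (m : ℤ) - (m / 8 : ℕ)) (R := (m : ℤ) - 1) (B := z' 1 - (m / 64 : ℕ)) (T := z' 1 + (m / 64 : ℕ))
    (by omega) (by omega) PG (by omega) (by omega)
    (fun v hv _ _ => by rw [sepInComb_strip_iff] at hv; omega) (Pa.trans Pb) hb.le ht.ge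
    (fun v hv _ _ => by rw [mem_sepInnerFence] at hv; omega)
  -- assemble inside the new arm region
  have R1 := sepInCorrHBox_subset_sepJoinRegion (N := N) (by omega) hmm' (by omega) z
  have R4 := sepInnerFence_subset_triAnnulusSet (N := N) hmm' (by omega) hz'
  have R5 := sepJoinRegion_subset_sepJoinRegion hmm' hN (z := z) hz' z''
  have RVh : triStrip ((m : ℤ) - 2 * (m / 8 : ℕ) - 2) (-(sepGlueHeight m : ℤ)) (m / 8) (sepGlueHeight m) ⊆ triAnnulusSet m' N :=
    fun v hv => by
      rw [mem_triStrip] at hv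
      exact mem_triAnnulusSet_of_cols_rows hmm' (by omega) (by omega) hv.1 (by omega) hv.2.2.1 (by omega)
  have RG : triStrip ((m : ℤ) - 2 * (m / 8 : ℕ) - 2) (-(sepGlueHeight m : ℤ) + i * ((m / 64 / 2 : ℕ) : ℤ)) (2 * (m / 8) + 1) (m / 64 / 2) ⊆
      triAnnulusSet m' N := fun v hv => by
    rw [sepInComb_strip_iff] at hv
    exact mem_triAnnulusSet_of_cols_rows hmm' (by omega) (by omega) hv.1 hv.2.1 (by omega) (by omega)
  have hann : triAnnulusSet m' N ⊆ sepJoinRegion m' N z z'' := fun v hv => Or.inl (Or.inl hv)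
  have P1 : PathIn triGraph (sepJoinRegion m' N z z'' ∩ ω) p₁ a₀ := by
    refine Q1.mono ?_
    exact fun v hv => ⟨R1 hv.1, hv.2⟩
  have P2 : PathIn triGraph (sepJoinRegion m' N z z'' ∩ ω) a₀ bh := by
    refine Q2.mono ?_
    rintro v ⟨hv | hv, hvω⟩
    exacts [⟨R1 hv, hvω⟩, ⟨hann (RVh hv), hvω⟩]
  have P3 : PathIn triGraph (sepJoinRegion m' N z z'' ∩ ω) bh g₀ := by
    refine Q3.symm.mono ?_
    rintro v ⟨hv | hv, hvω⟩
    exacts [⟨hann (RG hv), hvω⟩, ⟨hann (RVh hv), hvω⟩]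
  have P4 : PathIn triGraph (sepJoinRegion m' N z z'' ∩ ω) g₀ b := by
    refine Q4.mono ?_
    rintro v ⟨hv | hv, hvω⟩
    exacts [⟨hann (RG hv), hvω⟩, ⟨hann (R4 hv), hvω⟩]
  have P6 : PathIn triGraph (sepJoinRegion m' N z z'' ∩ ω) b u := by
    refine Pa.mono ?_
    exact fun v hv => ⟨hann (R4 hv.1), hv.2⟩
  have P7 : PathIn triGraph (sepJoinRegion m' N z z'' ∩ ω) u u' := by
    refine P5.mono ?_
    exact fun v hv => ⟨R5 hv.1, hv.2⟩
  exact ⟨z, z'', p₁, u', hz, mk_mem_sepLanding m', hFence, hOut, ((((P1.trans P2).trans P3).trans P4).trans P6).trans P7⟩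

/-- **Inward extension of both arms**: the corridor and its image under the central symmetry
serve the open and the closed arm, `sepTwoArm m N ∩ (sepInCorr m m' ∩ negFlip ⁻¹' sepInCorr m m') ⊆
sepTwoArm m' N` (`negFlip` exchanges "open arm landing on the right" with "closed arm landing on
the left"). [cite: Nolin2008, §4.3 Prop. 12 (i) (proof) (arXiv 0711.4948: Prop. 11)] -/
theorem sepTwoArm_inter_sepInCorr_subset {m m' N : ℕ} (hm' : 1100 ≤ m') (hmm' : 2 * m' + 1 ≤ m) (hN : 2 * m ≤ N) :
    sepTwoArm m N ∩ (sepInCorr m m' ∩ negFlip ⁻¹' sepInCorr m m') ⊆ sepTwoArm m' N := by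
  rintro ω ⟨⟨hO, hC⟩, hG, hG'⟩
  exact ⟨sepOpenArm_inter_sepInCorr_subset hm' hmm' hN ⟨hO, hG⟩, sepOpenArm_inter_sepInCorr_subset hm' hmm' hN ⟨hC, hG'⟩⟩

/-! ### Locality and probability of the corridor -/

/-- The sites of the boxes of the corridor. [folklore] -/
def sepInCorrFinset (m m' : ℕ) : Finset (Site 2) :=
  triStripFinset ((m' : ℤ) - (m' / 8 : ℕ) + 1) (-((m' / 2 : ℕ) : ℤ) - (m' / 64 : ℕ)) (m' / 8 - 2) (2 * (m' / 64)) ∪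
    triStripFinset ((m' : ℤ) - (m' / 8 : ℕ) + 1) (-((m' / 2 : ℕ) : ℤ)) (m - m / 8 - m' + m' / 8 - 3) (m' / 64) ∪
    triStripFinset ((m : ℤ) - 2 * (m / 8 : ℕ) - 2) (-(sepGlueHeight m : ℤ)) (m / 8) (sepGlueHeight m) ∪
    (Finset.range 90).biUnion fun i =>
      triStripFinset ((m : ℤ) - 2 * (m / 8 : ℕ) - 2) (-(sepGlueHeight m : ℤ) + i * ((m / 64 / 2 : ℕ) : ℤ)) (2 * (m / 8) + 1) (m / 64 / 2)

/-- The boxes of the corridor lie in the right half `{|v| < m, x₀ > 0}` of `Λ̊_m`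
(`64 ≤ m'`, `2m' + 1 ≤ m`). [folklore] -/
theorem sepInCorrFinset_subset {m m' : ℕ} (hm' : 64 ≤ m') (hmm' : 2 * m' + 1 ≤ m) {v : Site 2} (hv : v ∈ sepInCorrFinset m m') :
    triNorm v < m ∧ 0 < v 0 := by
  have hH : (sepGlueHeight m : ℤ) = (m : ℤ) - (m / 4 : ℕ) + (m / 64 : ℕ) := by unfold sepGlueHeight; omega
  simp only [sepInCorrFinset, Finset.mem_union, Finset.mem_biUnion, Finset.mem_range] at hv
  rcases hv with ((hv | hv) | hv) | ⟨i, hi, hv⟩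
  · rw [← Finset.mem_coe, coe_triStripFinset, mem_triStrip] at hv
    have e : ((m' / 8 - 2 : ℕ) : ℤ) = (m' / 8 : ℕ) - 2 := by omega
    rw [e] at hv
    simp only [Nat.cast_mul, Nat.cast_ofNat] at hv
    exact ⟨triNorm_lt_iff_lin.2 (by omega), by omega⟩
  · rw [← Finset.mem_coe, coe_triStripFinset, mem_triStrip, cast_sepInCorr_width hm' hmm'] at hv
    exact ⟨triNorm_lt_iff_lin.2 (by omega), by omega⟩
  · rw [← Finset.mem_coe, coe_triStripFinset, mem_triStrip] at hv
    exact ⟨triNorm_lt_iff_lin.2 (by omega), by omega⟩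
  · rw [← Finset.mem_coe, coe_triStripFinset, sepInComb_strip_iff] at hv
    have hih : (0 : ℤ) ≤ (i : ℤ) * ((m / 64 / 2 : ℕ) : ℤ) := by positivity
    have hih' : (i : ℤ) * ((m / 64 / 2 : ℕ) : ℤ) ≤ 89 * ((m / 64 / 2 : ℕ) : ℤ) :=
      mul_le_mul_of_nonneg_right (by exact_mod_cast Nat.le_of_lt_succ hi) (by positivity)
    exact ⟨triNorm_lt_iff_lin.2 (by omega), by omega⟩

/-- `sepInCorr` is determined by the sites of its boxes. [folklore] -/
theorem determinedBy_sepInCorr (m m' : ℕ) : DeterminedBy (sepInCorr m m') ↑(sepInCorrFinset m m') := by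
  have c1 : (↑(triStripFinset ((m' : ℤ) - (m' / 8 : ℕ) + 1) (-((m' / 2 : ℕ) : ℤ) - (m' / 64 : ℕ)) (m' / 8 - 2) (2 * (m' / 64))) : Set (Site 2)) ⊆
      ↑(sepInCorrFinset m m') :=
    Finset.coe_subset.2 (Finset.subset_union_left.trans (Finset.subset_union_left.trans Finset.subset_union_left))
  have c2 : (↑(triStripFinset ((m' : ℤ) - (m' / 8 : ℕ) + 1) (-((m' / 2 : ℕ) : ℤ)) (m - m / 8 - m' + m' / 8 - 3) (m' / 64)) : Set (Site 2)) ⊆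
      ↑(sepInCorrFinset m m') :=
    Finset.coe_subset.2 (Finset.subset_union_right.trans (Finset.subset_union_left.trans Finset.subset_union_left))
  have c3 : (↑(triStripFinset ((m : ℤ) - 2 * (m / 8 : ℕ) - 2) (-(sepGlueHeight m : ℤ)) (m / 8) (sepGlueHeight m)) : Set (Site 2)) ⊆
      ↑(sepInCorrFinset m m') :=
    Finset.coe_subset.2 (Finset.subset_union_right.trans Finset.subset_union_left)
  have c4 : (↑((Finset.range 90).biUnion fun i : ℕ =>
      triStripFinset ((m : ℤ) - 2 * (m / 8 : ℕ) - 2) (-(sepGlueHeight m : ℤ) + i * ((m / 64 / 2 : ℕ) : ℤ)) (2 * (m / 8) + 1) (m / 64 / 2)) :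
        Set (Site 2)) ⊆ ↑(sepInCorrFinset m m') :=
    Finset.coe_subset.2 Finset.subset_union_right
  refine ((((determinedBy_triVCross _ _ _ _).mono c1).inter ((determinedBy_triHCross _ _ _ _).mono c2)).inter
    ((determinedBy_triVCross _ _ _ _).mono c3)).inter ?_
  exact (DeterminedBy.biInter_finset (Finset.range 90) (E := fun i => sepInComb m i)
    (F := fun i : ℕ => triStripFinset ((m : ℤ) - 2 * (m / 8 : ℕ) - 2) (-(sepGlueHeight m : ℤ) + i * ((m / 64 / 2 : ℕ) : ℤ)) (2 * (m / 8) + 1) (m / 64 / 2))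
    fun i _ => determinedBy_triHCross _ _ _ _).mono c4

/-- **RSW and Harris for the corridor**: if `c ≤ P_{1/2}(long-way crossing of [0, 256 n] × [0, n])`
for all `n ≥ 1` (`c ≥ 0`), then `P(sepInCorr m m') ≥ c^93` for `1100 ≤ m'`, `2m' + 1 ≤ m ≤ 3m'` (all
`93` boxes have aspect ratio at most `256`). [cite: Nolin2008, §4.3 Prop. 12 (proof) (arXiv 0711.4948: Prop. 11)] -/
theorem le_real_sepInCorr {c : ℝ} (hrsw : ∀ n : ℕ, 1 ≤ ⌊(256 : ℝ) * n⌋₊ → c ≤ triLRCrossingProb half ⌊(256 : ℝ) * n⌋₊ n)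
    (hc : 0 ≤ c) {m m' : ℕ} (hm' : 1100 ≤ m') (hmm' : 2 * m' + 1 ≤ m) (hm3 : m ≤ 3 * m') :
    c ^ 93 ≤ (triSitePercolation half).real (sepInCorr m m') := by
  classical
  have hfl : ∀ n : ℕ, ⌊(256 : ℝ) * (n : ℕ)⌋₊ = 256 * n := fun n => by
    have : (256 : ℝ) * (n : ℕ) = ((256 * n : ℕ) : ℝ) := by push_cast; ring
    rw [this, Nat.floor_natCast]
  have hcw : ∀ L n : ℕ, 1 ≤ n → L ≤ 256 * n → c ≤ triLRCrossingProb half L n := fun L n hn hL => by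
    have h := hrsw n (by rw [hfl]; omega)
    rw [hfl] at h
    exact h.trans (triLRCrossingProb_anti_width half hL n)
  set F := sepInCorrFinset m m' with hF
  set E1 := triVCross ((m' : ℤ) - (m' / 8 : ℕ) + 1) (-((m' / 2 : ℕ) : ℤ) - (m' / 64 : ℕ)) (m' / 8 - 2) (2 * (m' / 64)) with hE1
  set E2 := triHCross ((m' : ℤ) - (m' / 8 : ℕ) + 1) (-((m' / 2 : ℕ) : ℤ)) (m - m / 8 - m' + m' / 8 - 3) (m' / 64) with hE2
  set E3 := triVCross ((m : ℤ) - 2 * (m / 8 : ℕ) - 2) (-(sepGlueHeight m : ℤ)) (m / 8) (sepGlueHeight m) with hE3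
  set G := ⋂ i ∈ Finset.range 90, sepInComb m i with hG
  have c1 : (↑(triStripFinset ((m' : ℤ) - (m' / 8 : ℕ) + 1) (-((m' / 2 : ℕ) : ℤ) - (m' / 64 : ℕ)) (m' / 8 - 2) (2 * (m' / 64))) : Set (Site 2)) ⊆ ↑F :=
    Finset.coe_subset.2 (Finset.subset_union_left.trans (Finset.subset_union_left.trans Finset.subset_union_left))
  have c2 : (↑(triStripFinset ((m' : ℤ) - (m' / 8 : ℕ) + 1) (-((m' / 2 : ℕ) : ℤ)) (m - m / 8 - m' + m' / 8 - 3) (m' / 64)) : Set (Site 2)) ⊆ ↑F :=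
    Finset.coe_subset.2 (Finset.subset_union_right.trans (Finset.subset_union_left.trans Finset.subset_union_left))
  have c3 : (↑(triStripFinset ((m : ℤ) - 2 * (m / 8 : ℕ) - 2) (-(sepGlueHeight m : ℤ)) (m / 8) (sepGlueHeight m)) : Set (Site 2)) ⊆ ↑F :=
    Finset.coe_subset.2 (Finset.subset_union_right.trans Finset.subset_union_left)
  have c4 : (↑((Finset.range 90).biUnion fun i : ℕ =>
      triStripFinset ((m : ℤ) - 2 * (m / 8 : ℕ) - 2) (-(sepGlueHeight m : ℤ) + i * ((m / 64 / 2 : ℕ) : ℤ)) (2 * (m / 8) + 1) (m / 64 / 2)) :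
        Set (Site 2)) ⊆ ↑F :=
    Finset.coe_subset.2 Finset.subset_union_right
  have d1 : DeterminedBy E1 ↑F := (determinedBy_triVCross _ _ _ _).mono c1
  have d2 : DeterminedBy E2 ↑F := (determinedBy_triHCross _ _ _ _).mono c2
  have d3 : DeterminedBy E3 ↑F := (determinedBy_triVCross _ _ _ _).mono c3
  have dG : DeterminedBy G ↑F := (DeterminedBy.biInter_finset (Finset.range 90) (E := fun i => sepInComb m i)
    (F := fun i : ℕ => triStripFinset ((m : ℤ) - 2 * (m / 8 : ℕ) - 2) (-(sepGlueHeight m : ℤ) + i * ((m / 64 / 2 : ℕ) : ℤ)) (2 * (m / 8) + 1) (m / 64 / 2))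
    fun i _ => determinedBy_triHCross _ _ _ _).mono c4
  have u1 : IsUpperSet E1 := isUpperSet_triVCross _ _ _ _
  have u2 : IsUpperSet E2 := isUpperSet_triHCross _ _ _ _
  have u3 : IsUpperSet E3 := isUpperSet_triVCross _ _ _ _
  have uG : IsUpperSet G := isUpperSet_iInter₂ fun i _ => isUpperSet_triHCross _ _ _ _
  have hHb : sepGlueHeight m ≤ m := by unfold sepGlueHeight; omega
  have hH1 : 1 ≤ m / 8 := by omega
  have e1 : c ≤ (triSitePercolation half).real E1 := by
    rw [hE1, triSitePercolation_real_triVCross]; exact hcw _ _ (by omega) (by omega)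
  have e2 : c ≤ (triSitePercolation half).real E2 := by
    rw [hE2, triSitePercolation_real_triHCross]; exact hcw _ _ (by omega) (by omega)
  have e3 : c ≤ (triSitePercolation half).real E3 := by
    rw [hE3, triSitePercolation_real_triVCross]; exact hcw _ _ hH1 (by omega)
  have eG : c ^ 90 ≤ (triSitePercolation half).real G := by
    have hprod := sitePercolation_real_biInter_ge_prod half (Finset.range 90) (E := fun i => sepInComb m i)
      (F := fun i => triStripFinset ((m : ℤ) - 2 * (m / 8 : ℕ) - 2) (-(sepGlueHeight m : ℤ) + i * ((m / 64 / 2 : ℕ) : ℤ)) (2 * (m / 8) + 1) (m / 64 / 2))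
      (fun i _ => determinedBy_triHCross _ _ _ _) (fun i _ => isUpperSet_triHCross _ _ _ _)
    have heach : ∀ i ∈ Finset.range 90, c ≤ (sitePercolation (Site 2) half).real (sepInComb m i) := fun i _ => by
      have := triSitePercolation_real_triHCross half ((m : ℤ) - 2 * (m / 8 : ℕ) - 2)
        (-(sepGlueHeight m : ℤ) + i * ((m / 64 / 2 : ℕ) : ℤ)) (2 * (m / 8) + 1) (m / 64 / 2)
      unfold triSitePercolation at this
      rw [sepInComb, this]
      exact hcw _ _ (by omega) (by omega)
    have hle : c ^ 90 ≤ ∏ i ∈ Finset.range 90, (sitePercolation (Site 2) half).real (sepInComb m i) := by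
      calc c ^ 90 = ∏ _i ∈ Finset.range 90, c := by rw [Finset.prod_const, Finset.card_range]
        _ ≤ _ := Finset.prod_le_prod (fun _ _ => hc) heach
    unfold triSitePercolation
    exact hle.trans hprod
  have h12 := sitePercolation_harris half d1 d2 u1 u2
  have h123 := sitePercolation_harris half (d1.inter d2) d3 (u1.inter u2) u3
  have h1234 := sitePercolation_harris half ((d1.inter d2).inter d3) dG ((u1.inter u2).inter u3) uG
  have hdef : sepInCorr m m' = E1 ∩ E2 ∩ E3 ∩ G := rfl
  unfold triSitePercolation at e1 e2 e3 eG ⊢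
  rw [hdef]
  set μ := sitePercolation (Site 2) half with hμ
  have h0 : ∀ s, 0 ≤ μ.real s := fun s => measureReal_nonneg
  calc c ^ 93 = c * c * c * c ^ 90 := by ring
    _ ≤ μ.real E1 * μ.real E2 * μ.real E3 * μ.real G := by
        have := mul_le_mul e1 e2 hc (h0 _)
        have := mul_le_mul this e3 hc (mul_nonneg (h0 _) (h0 _))
        exact mul_le_mul this eG (pow_nonneg hc _) (mul_nonneg (mul_nonneg (h0 _) (h0 _)) (h0 _))
    _ ≤ μ.real (E1 ∩ E2) * μ.real E3 * μ.real G :=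
        mul_le_mul_of_nonneg_right (mul_le_mul_of_nonneg_right h12 (h0 _)) (h0 _)
    _ ≤ μ.real (E1 ∩ E2 ∩ E3) * μ.real G := mul_le_mul_of_nonneg_right h123 (h0 _)
    _ ≤ μ.real (E1 ∩ E2 ∩ E3 ∩ G) := h1234

/-! ### The extension inequality -/

/-- **Inward extension at constant cost** (Nolin 2008, Prop. 12 (i) on the internal boundary,
via Lemma 13): if `c ≤ P_{1/2}(long-way crossing of [0, 256 n] × [0, n])` for all `n ≥ 1`
(`c ≥ 0`), then for `1100 ≤ m'`, `2m' + 1 ≤ m ≤ 3m'`, `2m ≤ N`,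
`P(sepTwoArm m N) · (c^93)² ≤ P(sepTwoArm m' N)`: the generalised FKG inequality
(`triSitePercolation_locallyMonotone_fkg`) with the shared region `{m ≤ |v|}` (on which both landed
arm events depend outside `Λ̊_m`), the right half `{|v| < m, x₀ > 0}` (open arm's inner free
spaces and the open corridor) and the left half (closed arm's), the invariance of `P_{1/2}` under
`negFlip`, and the deterministic gluing `sepTwoArm_inter_sepInCorr_subset`. [cite: Nolin2008, §4.3 Prop. 12 (i) and Lemma 13 (arXiv 0711.4948: Prop. 11, Lemma 12)] -/
theorem real_sepTwoArm_mul_le {c : ℝ} (hrsw : ∀ n : ℕ, 1 ≤ ⌊(256 : ℝ) * n⌋₊ → c ≤ triLRCrossingProb half ⌊(256 : ℝ) * n⌋₊ n)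
    (hc : 0 ≤ c) {m m' N : ℕ} (hm' : 1100 ≤ m') (hmm' : 2 * m' + 1 ≤ m) (hm3 : m ≤ 3 * m') (hN : 2 * m ≤ N) :
    (triSitePercolation half).real (sepTwoArm m N) * (c ^ 93) ^ 2 ≤ (triSitePercolation half).real (sepTwoArm m' N) := by
  classical
  -- the three pairwise disjoint regions of Nolin's Lemma 13
  set S : Finset (Site 2) := (triBall (N + N / 8)).filter (fun v => (m : ℤ) ≤ triNorm v) with hS
  set P : Finset (Site 2) := (triBall m).filter (fun v => triNorm v < m ∧ 0 < v 0) with hP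
  set M : Finset (Site 2) := (triBall m).filter (fun v => triNorm v < m ∧ v 0 < 0) with hM
  have hSP : Disjoint S P := by
    rw [Finset.disjoint_left]; intro v hvS hvP
    simp only [hS, hP, Finset.mem_filter] at hvS hvP
    omega
  have hSM : Disjoint S M := by
    rw [Finset.disjoint_left]; intro v hvS hvM
    simp only [hS, hM, Finset.mem_filter] at hvS hvM
    omega
  have hPM : Disjoint P M := by
    rw [Finset.disjoint_left]; intro v hvP hvM
    simp only [hP, hM, Finset.mem_filter] at hvP hvM
    omega
  have hmN : m ≤ N := by omega
  -- supports
  have hT : sepSupportSet m N ⊆ ↑S ∪ ↑P := by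
    intro v hv
    rw [mem_sepSupportSet] at hv
    simp only [hS, hP, Set.mem_union, Finset.mem_coe, Finset.mem_filter, mem_triBall_iff]
    push_cast at hv ⊢
    by_cases h : (m : ℤ) ≤ triNorm v
    · left; exact ⟨by omega, h⟩
    · right; exact ⟨by omega, by omega, hv.2.2 (Or.inl (by omega))⟩
  have hT' : Neg.neg ⁻¹' sepSupportSet m N ⊆ ↑S ∪ ↑M := by
    intro v hv
    rw [Set.mem_preimage, mem_sepSupportSet, triNorm_neg] at hv
    simp only [Pi.neg_apply] at hv
    simp only [hS, hM, Set.mem_union, Finset.mem_coe, Finset.mem_filter, mem_triBall_iff]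
    push_cast at hv ⊢
    by_cases h : (m : ℤ) ≤ triNorm v
    · left; exact ⟨by omega, h⟩
    · right; exact ⟨by omega, by omega, by have := hv.2.2 (Or.inl (by omega)); omega⟩
  have hGP : (↑(sepInCorrFinset m m') : Set (Site 2)) ⊆ ↑P := by
    intro v hv
    have h := sepInCorrFinset_subset (by omega) hmm' (Finset.mem_coe.1 hv)
    simp only [hP, Finset.mem_coe, Finset.mem_filter, mem_triBall_iff]
    exact ⟨h.1.le, h.1, h.2⟩
  have hGM : Neg.neg ⁻¹' (↑(sepInCorrFinset m m') : Set (Site 2)) ⊆ ↑M := by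
    intro v hv
    have h := sepInCorrFinset_subset (by omega) hmm' (Finset.mem_coe.1 (Set.mem_preimage.1 hv))
    rw [triNorm_neg] at h
    simp only [Pi.neg_apply] at h
    simp only [hM, Finset.mem_coe, Finset.mem_filter, mem_triBall_iff]
    exact ⟨h.1.le, h.1, by omega⟩
  -- locality of the events and Nolin's Lemma 13
  have d := determinedBy_sepOpenArm hmN
  have dG := determinedBy_sepInCorr m m'
  have fkg := triSitePercolation_locallyMonotone_fkg half hSP hSM hPM
    (Ap := sepOpenArm m N) (Am := negFlip ⁻¹' sepOpenArm m N) (Bp := sepInCorr m m') (Bm := negFlip ⁻¹' sepInCorr m m')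
    (isUpperSet_sepOpenArm m N) (IsUpperSet.preimage_negFlip (isUpperSet_sepOpenArm m N))
    (isUpperSet_sepInCorr m m') (IsUpperSet.preimage_negFlip (isUpperSet_sepInCorr m m'))
    (d.mono hT) (d.preimage_negFlip.mono hT') (dG.mono hGP) (dG.preimage_negFlip.mono hGM)
  have hGG := triSitePercolation_real_preimage_negFlip (sepInCorr m m')
  have hcorr := le_real_sepInCorr hrsw hc hm' hmm' hm3
  have hsub := sepTwoArm_inter_sepInCorr_subset hm' hmm' hN
  have h0 : 0 ≤ (triSitePercolation half).real (sepTwoArm m N) := measureReal_nonneg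
  calc (triSitePercolation half).real (sepTwoArm m N) * (c ^ 93) ^ 2
      ≤ (triSitePercolation half).real (sepTwoArm m N) *
          ((triSitePercolation half).real (sepInCorr m m') * (triSitePercolation half).real (negFlip ⁻¹' sepInCorr m m')) := by
        rw [hGG, sq]
        exact mul_le_mul_of_nonneg_left (mul_le_mul hcorr hcorr (pow_nonneg hc _) measureReal_nonneg) h0
    _ ≤ (triSitePercolation half).real (sepOpenArm m N ∩ negFlip ⁻¹' sepOpenArm m N ∩ (sepInCorr m m' ∩ negFlip ⁻¹' sepInCorr m m')) := fkg
    _ ≤ (triSitePercolation half).real (sepTwoArm m' N) := measureReal_mono hsub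

/-- **The inward extension constant exists**: there is `C₀ ≥ 1` with
`P(sepTwoArm m N) ≤ C₀ · P(sepTwoArm m' N)` for all `1100 ≤ m'`, `2m' + 1 ≤ m ≤ 3m'`, `2m ≤ N`
(`tri_rsw_half_holds` at aspect ratio `256`). [cite: Nolin2008, §4.3 Prop. 12 (i) (arXiv 0711.4948: Prop. 11); §4.4 (constant C₀)] -/
theorem exists_real_sepTwoArm_le_mul_inward :
    ∃ C₀ : ℝ, 1 ≤ C₀ ∧ ∀ m m' N : ℕ, 1100 ≤ m' → 2 * m' + 1 ≤ m → m ≤ 3 * m' → 2 * m ≤ N →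
      (triSitePercolation half).real (sepTwoArm m N) ≤ C₀ * (triSitePercolation half).real (sepTwoArm m' N) := by
  obtain ⟨c, hc, hrsw⟩ := tri_rsw_half_holds 256 (by norm_num)
  have hc1 : c ≤ 1 := by
    have h := (hrsw 1 (by norm_num)).1
    exact h.trans measureReal_le_one
  have hq : 0 < (c ^ 93) ^ 2 := by positivity
  refine ⟨1 / (c ^ 93) ^ 2, ?_, fun m m' N hm' hmm' hm3 hN => ?_⟩
  · rw [le_div_iff₀ hq, one_mul]
    calc (c ^ 93) ^ 2 ≤ (1 : ℝ) ^ 2 := by gcongr; exact pow_le_one₀ hc.le hc1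
      _ = 1 := one_pow 2
  · have h := real_sepTwoArm_mul_le (fun n hn => (hrsw n hn).1) hc.le hm' hmm' hm3 hN
    rw [one_div, ← div_eq_inv_mul, le_div_iff₀ hq]
    exact h

end Literature.Probability.Percolation
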